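import Literature.Computability.AlgebraicComplexity.DepthReductionProofs
import Literature.Computability.AlgebraicComplexity.VNPeEqVNP
import Literature.Computability.AlgebraicComplexity.AndrewsForbes2022BorderComposition

/-!
# Valiant–Skyum–Berkowitz–Rackoff in the product-depth model: circuits of product-depth `⌈log₂ d⌉`
# and polynomial size

Trunk T-CPLX-ALG. The depth reduction of Valiant–Skyum–Berkowitz–Rackoff (1983; Bürgisser 2000
TCS, Thm. 2.5: "`f` can be computed by a straight-line program of size `O(d⁶ L(f)³)` and depth
`O(log(d L(f)) log d + log n)`", with `O(log d)` levels of multiplications) in the unbounded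
fan-in / product-depth model of Limaye–Srinivasan–Tavenas 2021 (tree `ArithCircuit`,
`ArithCircuit.productDepth`, `ArithCircuit.edgeSize`):

* `exists_computes_productDepth_le_clog`: a polynomial `f` of total degree `≤ d` over `N`
  variables with fan-in-two complexity `L(f)` (`complexity`) is computed by an unbounded fan-in
  circuit of product-depth `≤ ⌈log₂ d⌉` with at most
  `vsbrEdgeBound N d L(f) = 9 (4 L(f) (d+1)² + 1)⁴ (N+1) (d+1)` wires;
* `SLP.exists_circuit_productDepth_le_clog`: the same for a value of a straight-line program
  (`GateQuotients.SLP`).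

## Proof

Homogenize the straight-line program (`SLP.homogenize`, Tavenas 2015 Prop. 2, file
`GateQuotients.lean`: a certificate `H : HomCircuit` on `≤ 4 L (d+1)²` nodes `ν` with formal
degrees, values `[ν]` and gate quotients `[ν : μ]`). The *atoms* `[ν]`, `[ν : μ]` of `H` satisfy
the `×`-balanced one-step expansion of Valiant–Skyum–Berkowitz–Rackoff / Agrawal–Vinay /
Tavenas §5 (`HomCircuit.expandAtom`, `expandAtom_sum`, `expandAtom_half`,
`expandAtom_length_le`): an atom of formal degree `D ≥ 2` is a sum of at most `#ι²` products of
at most `5` atoms, each of formal degree `≤ D / 2`. Hence the circuit with LEVELS `j = 0, …, Λ`,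
level `j` holding one value gate per atom — level `0`: the affine gate of the atom's value
(`ArithCircuit.affineGate`; correct for the atoms of formal degree `≤ 1`, whose values have total
degree `≤ 1`); level `j + 1`: for an atom of formal degree `≥ 2` the sum of one product gate per
term of its expansion, reading the level-`j` value gates, else a copy of its level-`j` gate —
computes at level `j` every atom of formal degree `≤ 2ʲ` (`gateValues_gatesUpTo`), has
product-depth `≤ j` (`depths_gatesUpTo_le`) and `#atoms (N+1) + j · #atoms (6 #ι² + 1)` wires
(`fanIn_sum_gatesUpTo_le`). The output gate sums the level-`⌈log₂ d⌉` gates of the nodes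
`(i, Q e)`, `e ≤ d`, holding the homogeneous components of the value of line `i`
(`vsbrCircuit`, `eval_vsbrCircuit`). This is the VSBR recursion `[ν] = Σ_w [ν : w] [w₁] [w₂]`,
`[ν : μ] = Σ_w [ν : w] [light w] [heavy w : μ]` organised by formal degree (`VSBRStages.lean`
organises the same identities by stages for the Boolean part); the number of product LEVELS is
exactly `⌈log₂ d⌉`, the printed `O(log d)`.

## Comparison with print

VSBR state size `O(d⁶ L³)` and total depth `O(log d (log d + log L))` for FAN-IN-TWO circuits;
here only the product-depth (number of multiplication levels, `⌈log₂ d⌉`) and a polynomial wire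
bound in the unbounded fan-in model are asserted — the form used by constant-depth / product-depth
hierarchies (LST 2021 §1: `VP` has product-depth `O(log d)`). Nothing sharper than print is
claimed; the wire bound `9 (4L(d+1)²+1)⁴ (N+1)(d+1)` is cruder than `O(d⁶ L³)`.

## References

* L. G. Valiant, S. Skyum, S. Berkowitz, C. Rackoff, *Fast parallel computation of polynomials
  using few processors*, SIAM J. Comput. 12 (1983) 641–644.
* P. Bürgisser, *Cook's versus Valiant's hypothesis*, Theoret. Comput. Sci. 235 (2000), Thm. 2.5.
* S. Tavenas, *Improved bounds for reduction to depth 4 and depth 3*, Inform. Comput. 240 (2015),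
  §4–§5 (homogenization, gate quotients, `×`-balanced expansion) — as formalised in
  `GateQuotients.lean`.
* N. Limaye, S. Srinivasan, S. Tavenas, *Superpolynomial lower bounds against low-depth algebraic
  circuits*, FOCS 2021, §1 (product depth).
-/

noncomputable section

open MvPolynomial

namespace Literature.Computability.AlgebraicComplexity.DepthReduction

universe u v w

open ArithCircuit

/-! ### Affine gates (product-depth `0`): bookkeeping

The level-`0` gates are the affine gates `ArithCircuit.affineGate` of
`AndrewsForbes2022BorderComposition.lean` (`(coeff 0 q) • 1 + Σ_x (coeff x q) • X_x`, computing
every `q` of total degree `≤ 1` without a product gate). -/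

section Affine

variable {k : Type u} {σ : Type v} [CommSemiring k] [Fintype σ] [DecidableEq σ]

/-- The operands of an affine gate are the constant `1` and variables (no gate references).
[folklore] -/
private theorem affineGate_refsBelow (q : MvPolynomial σ k) (n : ℕ) :
    ∀ u ∈ (affineGate q).args, u.RefsBelow n := by
  intro u hu
  simp only [affineGate, Gate.args, List.map_cons, List.map_map, List.mem_cons, List.mem_map,
    Function.comp] at hu
  rcases hu with rfl | ⟨x, -, rfl⟩ <;> trivial

end Affine

/-! ### Indexing the levels

The atoms `Atom ι` (a node `[ν]` or a gate quotient `[ν : μ]`) form a finite type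
(`instFintypeAtom`, `card_atom : #Atom ι = #ι + #ι²`, file `VNPeEqVNP.lean`); level `j` of the
circuit holds one value gate per atom, at index `vIdx j a`. -/

namespace HomCircuit

section Index

variable (ι : Type w) [Fintype ι]

/-- The maximal number of terms of one expansion step: `#ι²` (`length_expandAtom_le`).
[cite: Tavenas2015, §5 (proof of Prop. 3)] -/
def termWidth : ℕ := Fintype.card ι * Fintype.card ι

/-- The number of gates of one level `j ≥ 1` of the VSBR circuit: `#atoms · termWidth` product
gates and `#atoms` value gates. [cite: ValiantSkyumBerkowitzRackoff1983] -/
def blockLen : ℕ := Fintype.card (Atom ι) * termWidth ι + Fintype.card (Atom ι)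

/-- Index of the first value gate of level `j`. [cite: ValiantSkyumBerkowitzRackoff1983] -/
def vbase (j : ℕ) : ℕ := j * blockLen ι

/-- Number of gates of the levels `0, …, j`. [cite: ValiantSkyumBerkowitzRackoff1983] -/
def plen (j : ℕ) : ℕ := vbase ι j + Fintype.card (Atom ι)

variable {ι}

/-- Index of the value gate of the atom `a` at level `j`. [cite: ValiantSkyumBerkowitzRackoff1983] -/
def vIdx (j : ℕ) (a : Atom ι) : ℕ := vbase ι j + (Fintype.equivFin (Atom ι) a).val

/-- `vIdx j a < plen j`. [folklore] -/
private theorem vIdx_lt_plen (j : ℕ) (a : Atom ι) : vIdx j a < plen ι j :=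
  Nat.add_lt_add_left (Fintype.equivFin (Atom ι) a).isLt _

/-- `plen (j + 1) = plen j + #atoms·#terms + #atoms`. [folklore] -/
private theorem plen_succ (j : ℕ) :
    plen ι (j + 1) = plen ι j + Fintype.card (Atom ι) * termWidth ι + Fintype.card (Atom ι) := by
  simp only [plen, vbase, blockLen]; ring

/-- `vbase (j + 1) = plen j + #atoms·#terms`. [folklore] -/
private theorem vbase_succ (j : ℕ) :
    vbase ι (j + 1) = plen ι j + Fintype.card (Atom ι) * termWidth ι := by
  simp only [plen, vbase, blockLen]; ring

end Index

/-! ### The levels of the VSBR circuit -/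

variable {k : Type u} {σ : Type v} {ι : Type w} [CommSemiring k]
variable (H : HomCircuit k σ ι) [DecidableEq ι] [Fintype ι]

/-- The `r`-th product gate of the atom `a` at level `j + 1`: the product of the level-`j` value
gates of the atoms of the `r`-th term of the `×`-balanced expansion of `a` (an empty sum gate,
value `0`, if the expansion has fewer than `r + 1` terms).
[cite: ValiantSkyumBerkowitzRackoff1983] [cite: Tavenas2015, §5 (proof of Prop. 3)] -/
def prodGate (j : ℕ) (a : Atom ι) (r : Fin (termWidth ι)) : Gate k σ :=
  if h : r.val < (H.expandAtom a).length then
    .prod (((H.expandAtom a)[r.val]).map fun b => Operand.gate (vIdx j b))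
  else .sum []

/-- The product layer of level `j + 1`: gate `(a, r)` at position `finProdFinEquiv (a, r)`.
[cite: ValiantSkyumBerkowitzRackoff1983] -/
def prodLayer (j : ℕ) : List (Gate k σ) :=
  (List.finRange (Fintype.card (Atom ι) * termWidth ι)).map fun q =>
    H.prodGate j ((Fintype.equivFin (Atom ι)).symm (finProdFinEquiv.symm q).1) (finProdFinEquiv.symm q).2

/-- The value gate of the atom `a` at level `j + 1`: the sum of its product gates if its formal
degree is `≥ 2` (the expansion identity `expandAtom_sum`), else a copy of its level-`j` value gate.
[cite: ValiantSkyumBerkowitzRackoff1983] [cite: Tavenas2015, §5 (proof of Prop. 3)] -/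
def sumGate (j : ℕ) (a : Atom ι) : Gate k σ :=
  if 2 ≤ H.adeg a then
    .sum ((List.finRange (termWidth ι)).map fun r =>
      (1, Operand.gate (plen ι j + (finProdFinEquiv (Fintype.equivFin (Atom ι) a, r)).val)))
  else .sum [(1, Operand.gate (vIdx j a))]

/-- The value layer of level `j + 1`. [cite: ValiantSkyumBerkowitzRackoff1983] -/
def sumLayer (j : ℕ) : List (Gate k σ) :=
  (List.finRange (Fintype.card (Atom ι))).map fun m => H.sumGate j ((Fintype.equivFin (Atom ι)).symm m)

omit [DecidableEq ι] in
/-- The product layer has `#atoms · #terms` gates. [folklore] -/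
private theorem length_prodLayer (j : ℕ) : (H.prodLayer j).length = Fintype.card (Atom ι) * termWidth ι := by
  simp [prodLayer]

omit [DecidableEq ι] in
/-- The value layer has one gate per atom. [folklore] -/
private theorem length_sumLayer (j : ℕ) : (H.sumLayer j).length = Fintype.card (Atom ι) := by
  simp [sumLayer]

omit [DecidableEq ι] in
/-- A product gate has fan-in `≤ 5` (Tavenas: every term has at most `5` atoms).
[cite: Tavenas2015, §4 Def. 4] -/
theorem fanIn_prodGate_le (j : ℕ) (a : Atom ι) (r : Fin (termWidth ι)) :
    (H.prodGate j a r).fanIn ≤ 5 := by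
  unfold prodGate
  split_ifs with h
  · simp only [Gate.fanIn, Gate.args, List.length_map]
    exact H.expandAtom_length_le (List.getElem_mem h)
  · simp [Gate.fanIn, Gate.args]

omit [DecidableEq ι] in
/-- A value gate has fan-in `≤ #terms + 1`. [folklore] -/
private theorem fanIn_sumGate_le (j : ℕ) (a : Atom ι) : (H.sumGate j a).fanIn ≤ termWidth ι + 1 := by
  unfold sumGate
  split_ifs <;> simp [Gate.fanIn, Gate.args]

/-! #### Values of one level -/

/-- Sum over `Fin W` of the entries of a list padded with `0`. [folklore] -/
private theorem sum_getD_zero {M : Type*} [AddCommMonoid M] : ∀ (l : List M) (W : ℕ), l.length ≤ W →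
    ∑ π : Fin W, l.getD π.val 0 = l.sum := by
  intro l
  induction l with
  | nil => intro W _; simp
  | cons a l ih =>
    intro W hW
    obtain ⟨W, rfl⟩ : ∃ W', W = W' + 1 := ⟨W - 1, by simp at hW; omega⟩
    rw [Fin.sum_univ_succ]
    simp only [Fin.val_zero, List.getD_cons_zero, Fin.val_succ, List.getD_cons_succ,
      List.sum_cons]
    rw [ih W (by simp at hW; omega)]

/-- A product gate of level `j + 1` of an atom of formal degree `≤ 2^(j+1)` computes the value
of its term, given correct level-`j` values of all atoms of formal degree `≤ 2^j` (×-balance: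
the atoms of the term have formal degree `≤ 2^j`). [cite: ValiantSkyumBerkowitzRackoff1983] [cite: Tavenas2015, §5 (proof of Prop. 3)] -/
theorem eval_prodGate (j : ℕ) (vals : List (MvPolynomial σ k))
    (hvals : ∀ b : Atom ι, H.adeg b ≤ 2 ^ j → vals[vIdx j b]? = some (H.aval b))
    {a : Atom ι} (ha : H.adeg a ≤ 2 ^ (j + 1)) (r : Fin (termWidth ι)) :
    (H.prodGate j a r).eval vals = ((H.expandAtom a).map H.tval).getD r.val 0 := by
  unfold prodGate
  rw [List.getD_eq_getElem?_getD, List.getElem?_map]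
  split_ifs with h
  · rw [List.getElem?_eq_getElem h]
    simp only [Gate.eval, List.map_map, Option.map_some, Option.getD_some, tval]
    congr 1
    apply List.map_congr_left
    intro b hb
    have hT : (H.expandAtom a)[r.val] ∈ H.expandAtom a := List.getElem_mem h
    have hb2 : H.adeg b ≤ 2 ^ j := by
      have := H.expandAtom_half hT b hb
      rw [pow_succ] at ha
      omega
    simp only [Function.comp, Operand.eval, List.getD_eq_getElem?_getD, hvals b hb2,
      Option.getD_some]
  · rw [List.getElem?_eq_none (by omega)]
    simp [Gate.eval]

/-- A value gate of level `j + 1` of an atom of formal degree `≤ 2^(j+1)` computes the value of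
the atom, given correct level-`j` values followed by the values of the product layer.
[cite: ValiantSkyumBerkowitzRackoff1983] [cite: Tavenas2015, §5 (proof of Prop. 3)] -/
theorem eval_sumGate (j : ℕ) (vals : List (MvPolynomial σ k)) (hlen : vals.length = plen ι j)
    (hvals : ∀ b : Atom ι, H.adeg b ≤ 2 ^ j → vals[vIdx j b]? = some (H.aval b))
    {a : Atom ι} (ha : H.adeg a ≤ 2 ^ (j + 1)) :
    (H.sumGate j a).eval (vals ++ (H.prodLayer j).map fun g => g.eval vals) = H.aval a := by
  generalize hp : (H.prodLayer j).map (fun g => g.eval vals) = pvals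
  unfold sumGate
  split_ifs with h2
  · have hle : ((H.expandAtom a).map H.tval).length ≤ termWidth ι := by
      rw [List.length_map]; exact H.length_expandAtom_le a
    simp only [Gate.eval, List.map_map]
    rw [← H.expandAtom_sum h2, ← sum_getD_zero _ _ hle, Fin.sum_univ_def]
    congr 1
    apply List.map_congr_left
    intro r _
    simp only [Function.comp, Operand.eval_gate, List.getD_eq_getElem?_getD, one_smul]
    rw [List.getElem?_append_right (by rw [hlen]; omega), hlen, Nat.add_sub_cancel_left,
      ← hp, List.getElem?_map, prodLayer, List.getElem?_map,
      List.getElem?_eq_getElem (by rw [List.length_finRange]; exact (finProdFinEquiv _).isLt)]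
    simp only [List.getElem_finRange, Fin.cast_mk, Option.map_some, Option.getD_some, Fin.eta,
      Equiv.symm_apply_apply]
    rw [H.eval_prodGate j vals hvals ha, List.getD_eq_getElem?_getD]
  · have ha1 : H.adeg a ≤ 2 ^ j := (show H.adeg a ≤ 1 by omega).trans Nat.one_le_two_pow
    simp only [Gate.eval, List.map_cons, List.map_nil, List.sum_cons, List.sum_nil, add_zero,
      Operand.eval_gate, List.getD_eq_getElem?_getD, one_smul]
    rw [List.getElem?_append_left (by rw [hlen]; exact vIdx_lt_plen j a), hvals a ha1,
      Option.getD_some]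

/-! #### All levels -/

variable [Fintype σ] [DecidableEq σ]

/-- Level `0`: one affine gate per atom (correct for the atoms of formal degree `≤ 1`).
[cite: ValiantSkyumBerkowitzRackoff1983] -/
def levelZero : List (Gate k σ) :=
  (List.finRange (Fintype.card (Atom ι))).map fun m => affineGate (H.aval ((Fintype.equivFin (Atom ι)).symm m))

/-- The gates of the levels `0, …, j` of the VSBR circuit. [cite: ValiantSkyumBerkowitzRackoff1983] -/
def gatesUpTo : ℕ → List (Gate k σ)
  | 0 => H.levelZero
  | j + 1 => gatesUpTo j ++ H.prodLayer j ++ H.sumLayer j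

/-- Level `0` has one gate per atom. [folklore] -/
private theorem length_levelZero : H.levelZero.length = Fintype.card (Atom ι) := by
  simp [levelZero]

/-- The levels `0, …, j` have `plen j` gates. [folklore] -/
private theorem length_gatesUpTo : ∀ j : ℕ, (H.gatesUpTo j).length = plen ι j
  | 0 => by simp [gatesUpTo, length_levelZero, plen, vbase]
  | j + 1 => by
    rw [gatesUpTo, List.length_append, List.length_append, length_gatesUpTo j,
      length_prodLayer, length_sumLayer, plen_succ]

/-- The product layer of level `j + 1` refers only to the levels `≤ j`. [folklore] -/
private theorem refs_prodLayer (j : ℕ) :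
    ∀ g ∈ H.prodLayer j, ∀ u ∈ g.args, u.RefsBelow (H.gatesUpTo j).length := by
  intro g hg u hu
  simp only [prodLayer, List.mem_map] at hg
  obtain ⟨q, -, rfl⟩ := hg
  unfold prodGate at hu
  split_ifs at hu with h
  · simp only [Gate.args, List.mem_map] at hu
    obtain ⟨b, -, rfl⟩ := hu
    simp only [Operand.RefsBelow, length_gatesUpTo]
    exact vIdx_lt_plen j b
  · simp [Gate.args] at hu

/-- The value layer of level `j + 1` refers only to the levels `≤ j` and its product layer.
[folklore] -/
private theorem refs_sumLayer (j : ℕ) :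
    ∀ g ∈ H.sumLayer j, ∀ u ∈ g.args, u.RefsBelow (H.gatesUpTo j ++ H.prodLayer j).length := by
  intro g hg u hu
  simp only [sumLayer, List.mem_map] at hg
  obtain ⟨m, -, rfl⟩ := hg
  unfold sumGate at hu
  rw [List.length_append, length_gatesUpTo, length_prodLayer]
  split_ifs at hu with h
  · simp only [Gate.args, List.map_map, List.mem_map, Function.comp] at hu
    obtain ⟨r, -, rfl⟩ := hu
    simp only [Operand.RefsBelow]
    have := (finProdFinEquiv (Fintype.equivFin (Atom ι) ((Fintype.equivFin (Atom ι)).symm m), r)).isLt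
    omega
  · simp only [Gate.args, List.map_cons, List.map_nil, List.mem_singleton] at hu
    subst hu
    simp only [Operand.RefsBelow]
    have := vIdx_lt_plen j ((Fintype.equivFin (Atom ι)).symm m : Atom ι)
    omega

/-- Level `0` refers to no gate. [folklore] -/
private theorem refs_levelZero :
    ∀ g ∈ H.levelZero, ∀ u ∈ g.args, u.RefsBelow ([] : List (Gate k σ)).length := by
  intro g hg u hu
  simp only [levelZero, List.mem_map] at hg
  obtain ⟨m, -, rfl⟩ := hg
  exact affineGate_refsBelow _ _ u hu

/-- **The invariant of the levels** (VSBR): the value gate of level `j` of every atom of formal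
degree `≤ 2^j` holds the value of the atom.
[cite: ValiantSkyumBerkowitzRackoff1983] [cite: Burgisser2000TCS, Thm. 2.5] -/
theorem gateValues_gatesUpTo : ∀ (j : ℕ) (a : Atom ι), H.adeg a ≤ 2 ^ j →
    (gateValues (H.gatesUpTo j))[vIdx j a]? = some (H.aval a)
  | 0, a, ha => by
    have h0 := gateValues_layer (k := k) (σ := σ) [] H.levelZero H.refs_levelZero
    simp only [List.nil_append] at h0
    rw [gatesUpTo, h0]
    simp only [gateValues, List.foldl_nil, List.nil_append, vIdx, vbase, zero_mul, zero_add,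
      levelZero, List.map_map, List.getElem?_map]
    rw [List.getElem?_eq_getElem (by rw [List.length_finRange]; exact (Fintype.equivFin (Atom ι) a).isLt)]
    simp only [List.getElem_finRange, Fin.cast_mk, Option.map_some, Fin.eta, Function.comp,
      Equiv.symm_apply_apply]
    rw [eval_affineGate _ ((H.totalDegree_aval_le a).trans (by simpa using ha))]
  | j + 1, a, ha => by
    have ih := gateValues_gatesUpTo j
    have hlenj : (gateValues (H.gatesUpTo j)).length = plen ι j := by
      rw [gateValues_length, length_gatesUpTo]
    rw [gatesUpTo, gateValues_layer _ _ (H.refs_sumLayer j),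
      gateValues_layer _ _ (H.refs_prodLayer j)]
    have hlen : (gateValues (H.gatesUpTo j) ++
        (H.prodLayer j).map fun g => g.eval (gateValues (H.gatesUpTo j))).length =
        vbase ι (j + 1) := by
      rw [List.length_append, List.length_map, hlenj, length_prodLayer, vbase_succ]
    rw [vIdx, List.getElem?_append_right (by rw [hlen]; exact Nat.le_add_right _ _), hlen,
      Nat.add_sub_cancel_left, List.getElem?_map, sumLayer, List.getElem?_map,
      List.getElem?_eq_getElem (by rw [List.length_finRange]; exact (Fintype.equivFin (Atom ι) a).isLt)]
    simp only [List.getElem_finRange, Fin.cast_mk, Option.map_some, Fin.eta,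
      Equiv.symm_apply_apply]
    rw [H.eval_sumGate j _ hlenj ih ha]


/-! #### Product depth of the levels -/

/-- All gates of the levels `0, …, j` have product-depth `≤ j` (one layer of product gates per
level). [cite: ValiantSkyumBerkowitzRackoff1983] [cite: LimayeSrinivasanTavenas2021, §1] -/
theorem depths_gatesUpTo_le : ∀ j : ℕ,
    ∀ x ∈ gateWDepths (fun g : Gate k σ => if g.isProd then 1 else 0) (H.gatesUpTo j), x ≤ j
  | 0 => by
    intro x hx
    have h0 := gateWDepths_layer (fun g : Gate k σ => if g.isProd then 1 else 0) [] H.levelZero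
      H.refs_levelZero
    simp only [List.nil_append] at h0
    rw [gatesUpTo, h0] at hx
    simp only [gateWDepths, List.foldl_nil, List.nil_append, List.mem_map] at hx
    obtain ⟨g, hg, rfl⟩ := hx
    simp only [levelZero, List.mem_map] at hg
    obtain ⟨m, -, rfl⟩ := hg
    rw [foldr_depthIn_affineGate]
    simp [isProd_affineGate]
  | j + 1 => by
    have ih := depths_gatesUpTo_le j
    generalize hw : (fun g : Gate k σ => if g.isProd then 1 else 0) = w at ih ⊢
    have hw_prod : ∀ args, w (.prod args) = 1 := fun _ => by rw [← hw]; rfl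
    have hw_sum : ∀ args, w (.sum args) = 0 := fun _ => by rw [← hw]; rfl
    have hB : ∀ x ∈ gateWDepths w (H.gatesUpTo j ++ H.prodLayer j), x ≤ j + 1 := by
      rw [gateWDepths_layer w _ _ (H.refs_prodLayer j)]
      intro x hx
      rcases List.mem_append.1 hx with hx | hx
      · exact (ih x hx).trans (Nat.le_succ j)
      · obtain ⟨g, hg, rfl⟩ := List.mem_map.1 hx
        simp only [prodLayer, List.mem_map] at hg
        obtain ⟨q, -, rfl⟩ := hg
        unfold prodGate
        split_ifs with h
        · rw [hw_prod, Nat.add_comm]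
          exact Nat.succ_le_succ (foldr_max_le fun x hx => by
            obtain ⟨u, -, rfl⟩ := List.mem_map.1 hx
            exact depthIn_le ih u)
        · rw [hw_sum]
          simp [Gate.args]
    rw [gatesUpTo, gateWDepths_layer w _ _ (H.refs_sumLayer j)]
    intro x hx
    rcases List.mem_append.1 hx with hx | hx
    · exact hB x hx
    · obtain ⟨g, hg, rfl⟩ := List.mem_map.1 hx
      simp only [sumLayer, List.mem_map] at hg
      obtain ⟨m, -, rfl⟩ := hg
      have hfold : ∀ args : List (k × Operand k σ), w (.sum args) +
          ((Gate.args (Gate.sum args)).map (Operand.depthIn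
            (gateWDepths w (H.gatesUpTo j ++ H.prodLayer j)))).foldr max 0 ≤ j + 1 := by
        intro args
        rw [hw_sum, zero_add]
        exact foldr_max_le fun x hx => by
          obtain ⟨u, -, rfl⟩ := List.mem_map.1 hx
          exact depthIn_le hB u
      unfold sumGate
      split_ifs <;> exact hfold _

/-! #### Wires of the levels -/

/-- The levels `0, …, j` have at most `#atoms·(#σ+1) + j·(5·#atoms·#terms + #atoms·(#terms+1))`
wires. [cite: ValiantSkyumBerkowitzRackoff1983] -/
theorem fanIn_sum_gatesUpTo_le : ∀ j : ℕ, ((H.gatesUpTo j).map Gate.fanIn).sum ≤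
    Fintype.card (Atom ι) * (Fintype.card σ + 1) +
      j * (Fintype.card (Atom ι) * termWidth ι * 5 + Fintype.card (Atom ι) * (termWidth ι + 1))
  | 0 => by
    simp only [gatesUpTo, levelZero, List.map_map, Function.comp_def, fanIn_affineGate,
      List.map_const', List.sum_replicate, List.length_finRange, smul_eq_mul, zero_mul, add_zero,
      le_refl]
  | j + 1 => by
    have ih := fanIn_sum_gatesUpTo_le j
    rw [gatesUpTo, List.map_append, List.map_append, List.sum_append, List.sum_append]
    have hP : ((H.prodLayer j).map Gate.fanIn).sum ≤ Fintype.card (Atom ι) * termWidth ι * 5 := by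
      have h5 := List.sum_le_card_nsmul ((H.prodLayer j).map Gate.fanIn) 5 fun x hx => by
        obtain ⟨g, hg, rfl⟩ := List.mem_map.1 hx
        simp only [prodLayer, List.mem_map] at hg
        obtain ⟨q, -, rfl⟩ := hg
        exact H.fanIn_prodGate_le _ _ _
      rwa [List.length_map, length_prodLayer, smul_eq_mul] at h5
    have hS : ((H.sumLayer j).map Gate.fanIn).sum ≤ Fintype.card (Atom ι) * (termWidth ι + 1) := by
      have h5 := List.sum_le_card_nsmul ((H.sumLayer j).map Gate.fanIn) (termWidth ι + 1)
        fun x hx => by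
          obtain ⟨g, hg, rfl⟩ := List.mem_map.1 hx
          simp only [sumLayer, List.mem_map] at hg
          obtain ⟨m, -, rfl⟩ := hg
          exact H.fanIn_sumGate_le _ _
      rwa [List.length_map, length_sumLayer, smul_eq_mul] at h5
    calc _ ≤ Fintype.card (Atom ι) * (Fintype.card σ + 1) +
          j * (Fintype.card (Atom ι) * termWidth ι * 5 + Fintype.card (Atom ι) * (termWidth ι + 1)) +
          Fintype.card (Atom ι) * termWidth ι * 5 + Fintype.card (Atom ι) * (termWidth ι + 1) :=
        add_le_add (add_le_add ih hP) hS
      _ = _ := by ring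

/-! ### The VSBR circuit -/

/-- **The VSBR circuit** of product-depth `Λ` summing the values of the atoms `ns`: the levels
`0, …, Λ` followed by one output sum gate over the level-`Λ` value gates of the atoms of `ns`.
[cite: ValiantSkyumBerkowitzRackoff1983] [cite: Burgisser2000TCS, Thm. 2.5] -/
def vsbrCircuit (Λ : ℕ) (ns : List (Atom ι)) : ArithCircuit k σ where
  gates := H.gatesUpTo Λ ++ [.sum (ns.map fun a => (1, Operand.gate (vIdx Λ a)))]
  output := .gate (plen ι Λ)

/-- The output gate refers only to the levels. [folklore] -/
private theorem refs_top (Λ : ℕ) (ns : List (Atom ι)) :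
    ∀ g ∈ [(Gate.sum (ns.map fun a => ((1 : k), Operand.gate (vIdx Λ a))) : Gate k σ)],
      ∀ u ∈ g.args, u.RefsBelow (H.gatesUpTo Λ).length := by
  intro g hg u hu
  simp only [List.mem_singleton] at hg
  subst hg
  simp only [Gate.args, List.map_map, List.mem_map, Function.comp] at hu
  obtain ⟨a, -, rfl⟩ := hu
  simp only [Operand.RefsBelow, length_gatesUpTo]
  exact vIdx_lt_plen Λ a

/-- **Correctness of the VSBR circuit**: if every atom of `ns` has formal degree `≤ 2^Λ`, the
circuit computes the sum of their values. [cite: ValiantSkyumBerkowitzRackoff1983] [cite: Burgisser2000TCS, Thm. 2.5] -/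
theorem eval_vsbrCircuit (Λ : ℕ) (ns : List (Atom ι))
    (hns : ∀ a ∈ ns, H.adeg a ≤ 2 ^ Λ) :
    (H.vsbrCircuit Λ ns).eval = (ns.map H.aval).sum := by
  have hlen : (gateValues (H.gatesUpTo Λ)).length = plen ι Λ := by
    rw [gateValues_length, length_gatesUpTo]
  simp only [vsbrCircuit, ArithCircuit.eval]
  rw [gateValues_layer _ _ (H.refs_top Λ ns)]
  simp only [List.map_singleton, Operand.eval_gate, List.getD_eq_getElem?_getD]
  rw [List.getElem?_append_right (le_of_eq hlen), hlen, Nat.sub_self, List.getElem?_cons_zero,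
    Option.getD_some]
  simp only [Gate.eval, List.map_map]
  congr 1
  apply List.map_congr_left
  intro a ha
  simp only [Function.comp, Operand.eval_gate, one_smul, List.getD_eq_getElem?_getD]
  rw [H.gateValues_gatesUpTo Λ a (hns a ha), Option.getD_some]

/-- **Product depth of the VSBR circuit**: `≤ Λ`. [cite: ValiantSkyumBerkowitzRackoff1983] [cite: LimayeSrinivasanTavenas2021, §1] -/
theorem productDepth_vsbrCircuit_le (Λ : ℕ) (ns : List (Atom ι)) :
    (H.vsbrCircuit Λ ns).productDepth ≤ Λ := by
  unfold ArithCircuit.productDepth ArithCircuit.wdepth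
  have hD := H.depths_gatesUpTo_le Λ
  generalize hw : (fun g : Gate k σ => if g.isProd then 1 else 0) = w at hD ⊢
  have hw_sum : ∀ args, w (.sum args) = 0 := fun _ => by rw [← hw]; rfl
  have hall : ∀ x ∈ gateWDepths w (H.vsbrCircuit Λ ns).gates, x ≤ Λ := by
    simp only [vsbrCircuit]
    rw [gateWDepths_layer w _ _ (H.refs_top Λ ns)]
    intro x hx
    rcases List.mem_append.1 hx with hx | hx
    · exact hD x hx
    · simp only [List.map_singleton, List.mem_singleton] at hx
      subst hx
      rw [hw_sum, zero_add]
      exact foldr_max_le fun x hx => by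
        obtain ⟨u, -, rfl⟩ := List.mem_map.1 hx
        exact depthIn_le hD u
  exact depthIn_le hall _

/-- **Wires of the VSBR circuit**. [cite: ValiantSkyumBerkowitzRackoff1983] -/
theorem edgeSize_vsbrCircuit_le (Λ : ℕ) (ns : List (Atom ι)) :
    (H.vsbrCircuit Λ ns).edgeSize ≤ Fintype.card (Atom ι) * (Fintype.card σ + 1) +
      Λ * (Fintype.card (Atom ι) * termWidth ι * 5 + Fintype.card (Atom ι) * (termWidth ι + 1)) + ns.length := by
  unfold ArithCircuit.edgeSize
  simp only [vsbrCircuit, List.map_append, List.sum_append, List.map_singleton,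
    List.sum_singleton]
  have hfan : ((Gate.sum (ns.map fun a => ((1 : k), Operand.gate (vIdx Λ a)))) :
      Gate k σ).fanIn = ns.length := by
    simp [Gate.fanIn, Gate.args]
  rw [hfan]
  exact Nat.add_le_add_right (H.fanIn_sum_gatesUpTo_le Λ) _

end HomCircuit

/-! ### From straight-line programs and from `complexity` -/

/-- The wire bound of the VSBR circuit of a value of degree `≤ d` of a straight-line program of
length `s` over `N` variables: `9 · (4 s (d+1)² + 1)⁴ · (N + 1) · (d + 1)` (polynomial in
`s, d, N`; VSBR: size `O(d⁶ s³)` in the fan-in-two model). [cite: ValiantSkyumBerkowitzRackoff1983] [cite: Burgisser2000TCS, Thm. 2.5] -/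
def vsbrEdgeBound (N d s : ℕ) : ℕ := 9 * (4 * s * (d + 1) ^ 2 + 1) ^ 4 * (N + 1) * (d + 1)

/-- Arithmetic of the wire count: with `I ≤ I₀` nodes and `Λ ≤ d` levels the VSBR circuit has at
most `9 (I₀ + 1)⁴ (N + 1) (d + 1)` wires. [folklore] -/
private theorem edge_arith {I I₀ N d Λ L : ℕ} (hI : I ≤ I₀) (hΛ : Λ ≤ d) (hL : L ≤ d + 1) :
    (I + I * I) * (N + 1) + Λ * ((I + I * I) * (I * I) * 5 + (I + I * I) * (I * I + 1)) + L ≤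
      9 * (I₀ + 1) ^ 4 * (N + 1) * (d + 1) := by
  set J := I₀ + 1 with hJ
  have hJ1 : 1 ≤ J := by omega
  have hM : I + I * I ≤ J ^ 2 := by rw [hJ]; nlinarith
  have hR : (I + I * I) * (I * I) * 5 + (I + I * I) * (I * I + 1) ≤ 7 * J ^ 4 := by
    have h1 : I * I + 1 ≤ J ^ 2 := by rw [hJ]; nlinarith
    have h2 : I * I ≤ J ^ 2 := by rw [hJ]; nlinarith
    calc (I + I * I) * (I * I) * 5 + (I + I * I) * (I * I + 1)
        ≤ J ^ 2 * J ^ 2 * 5 + J ^ 2 * J ^ 2 :=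
          add_le_add (Nat.mul_le_mul_right _ (Nat.mul_le_mul hM h2)) (Nat.mul_le_mul hM h1)
      _ = 6 * J ^ 4 := by ring
      _ ≤ 7 * J ^ 4 := Nat.mul_le_mul_right _ (by norm_num)
  have hJ4 : 1 ≤ J ^ 4 := Nat.one_le_pow _ _ hJ1
  have hJ24 : J ^ 2 ≤ J ^ 4 := Nat.pow_le_pow_right hJ1 (by norm_num)
  set Q := J ^ 4 * (N + 1) * (d + 1) with hQ
  have h1 : (I + I * I) * (N + 1) ≤ Q := by
    calc (I + I * I) * (N + 1) ≤ J ^ 4 * (N + 1) := Nat.mul_le_mul_right _ (hM.trans hJ24)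
      _ ≤ Q := Nat.le_mul_of_pos_right _ (Nat.succ_pos d)
  have h2 : Λ * ((I + I * I) * (I * I) * 5 + (I + I * I) * (I * I + 1)) ≤ 7 * Q := by
    calc Λ * ((I + I * I) * (I * I) * 5 + (I + I * I) * (I * I + 1))
        ≤ (d + 1) * (7 * J ^ 4) := Nat.mul_le_mul (by omega) hR
      _ = 7 * (J ^ 4 * 1 * (d + 1)) := by ring
      _ ≤ 7 * Q := by
        apply Nat.mul_le_mul_left
        exact Nat.mul_le_mul_right _ (Nat.mul_le_mul_left _ (by omega))
  have h3 : L ≤ Q := by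
    calc L ≤ 1 * 1 * (d + 1) := by omega
      _ ≤ Q := Nat.mul_le_mul_right _ (Nat.mul_le_mul hJ4 (by omega))
  calc _ ≤ Q + 7 * Q + Q := add_le_add (add_le_add h1 h2) h3
    _ = 9 * (J ^ 4 * (N + 1) * (d + 1)) := by rw [hQ]; ring
    _ = 9 * J ^ 4 * (N + 1) * (d + 1) := by ring

namespace SLP

variable {k : Type u} {σ : Type v} [CommSemiring k] [Fintype σ] [DecidableEq σ] (S : SLP k σ)

/-- **VSBR for a value of a straight-line program** (product-depth form): a value of total degree
`≤ d` of a straight-line program of length `s` over `N` variables is computed by an unbounded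
fan-in circuit of product-depth `≤ ⌈log₂ d⌉` with at most `vsbrEdgeBound N d s` wires — the
levels of the `×`-balanced expansion of its homogenization.
[cite: ValiantSkyumBerkowitzRackoff1983] [cite: Burgisser2000TCS, Thm. 2.5] [cite: Tavenas2015, Prop. 3] -/
theorem exists_circuit_productDepth_le_clog {i : ℕ} (hi : i < S.len) {d : ℕ}
    (hd : (S.val i).totalDegree ≤ d) :
    ∃ C : ArithCircuit k σ, C.eval = S.val i ∧ C.productDepth ≤ Nat.clog 2 d ∧
      C.edgeSize ≤ vsbrEdgeBound (Fintype.card σ) d S.len := by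
  set H := S.homogenize d with hH
  set Λ := Nat.clog 2 d with hΛ
  set ns : List (HomCircuit.Atom (S.Node d)) :=
    (List.finRange (d + 1)).map fun e => .node (⟨i, hi⟩, Tag.Q e) with hns
  have hdeg : ∀ a ∈ ns, H.adeg a ≤ 2 ^ Λ := by
    intro a ha
    simp only [hns, List.mem_map] at ha
    obtain ⟨e, -, rfl⟩ := ha
    have he := e.isLt
    calc H.adeg (.node (⟨i, hi⟩, Tag.Q e)) = e.val := rfl
      _ ≤ d := by omega
      _ ≤ 2 ^ Λ := Nat.le_pow_clog one_lt_two d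
  refine ⟨H.vsbrCircuit Λ ns, ?_, H.productDepth_vsbrCircuit_le Λ ns, ?_⟩
  · rw [H.eval_vsbrCircuit Λ ns hdeg, hns, List.map_map]
    have hval : ∀ e : Fin (d + 1), (H.aval ∘ fun e : Fin (d + 1) =>
        HomCircuit.Atom.node ((⟨i, hi⟩ : Fin S.len), Tag.Q e)) e =
        homogeneousComponent e.val (S.val i) := fun e => rfl
    rw [List.map_congr_left (fun e _ => hval e), ← Fin.sum_univ_def,
      Fin.sum_univ_eq_sum_range (fun e => homogeneousComponent e (S.val i)) (d + 1),
      sum_homogeneousComponent_of_le hd]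
  · refine (H.edgeSize_vsbrCircuit_le Λ ns).trans ?_
    unfold vsbrEdgeBound HomCircuit.termWidth
    rw [HomCircuit.card_atom]
    refine edge_arith (S.card_node_le d) ?_ (by simp [hns])
    exact (Nat.clog_le_iff_le_pow one_lt_two).2 Nat.lt_two_pow_self.le

end SLP

/-- A gate-free circuit has no wires. [folklore] -/
private theorem edgeSize_eq_zero_of_gates_eq_nil {k : Type u} {σ : Type v} (P : ArithCircuit k σ)
    (h : P.gates = []) : P.edgeSize = 0 := by
  simp [ArithCircuit.edgeSize, h]

/-- **Valiant–Skyum–Berkowitz–Rackoff, product-depth form.** A polynomial of total degree `≤ d`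
over a finite set of `N` variables is computed by an unbounded fan-in arithmetic circuit of
product-depth `≤ ⌈log₂ d⌉` with at most `vsbrEdgeBound N d L(f)` wires, `L(f)` its fan-in-two
complexity (VSBR 1983: size `O(d⁶ L³)`, depth `O(log d · log(dL))` with `O(log d)` levels of
multiplications; Bürgisser 2000 TCS, Thm. 2.5).
[cite: ValiantSkyumBerkowitzRackoff1983] [cite: Burgisser2000TCS, Thm. 2.5 p. 77] -/
theorem exists_computes_productDepth_le_clog {k : Type u} {σ : Type v} [CommSemiring k]
    [Fintype σ] [DecidableEq σ] (f : MvPolynomial σ k) {d : ℕ} (hd : f.totalDegree ≤ d) :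
    ∃ C : ArithCircuit k σ, C.Computes f ∧ C.productDepth ≤ Nat.clog 2 d ∧
      C.edgeSize ≤ vsbrEdgeBound (Fintype.card σ) d (complexity f) := by
  obtain ⟨P, hfan, hcomp, hsize⟩ := ArithCircuit.exists_computes_size_eq_complexity f
  obtain ⟨S, hlen, hcases⟩ := exists_slp P hfan
  rw [show P.eval = f from hcomp] at hcases
  rcases hcases with ⟨i, hi, hfi⟩ | ⟨j, hfj⟩ | ⟨c, hfc⟩
  · have hdi : (S.val i).totalDegree ≤ d := by rw [← hfi]; exact hd
    obtain ⟨C, hCe, hCd, hCs⟩ := S.exists_circuit_productDepth_le_clog hi hdi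
    refine ⟨C, hCe.trans hfi.symm, hCd, ?_⟩
    rwa [hlen, hsize] at hCs
  · exact ⟨ArithCircuit.ofVar j, by rw [ArithCircuit.Computes, ArithCircuit.eval_ofVar, hfj],
      by rw [productDepth_ofVar]; exact Nat.zero_le _,
      by rw [edgeSize_eq_zero_of_gates_eq_nil _ rfl]; exact Nat.zero_le _⟩
  · exact ⟨ArithCircuit.ofConst c, by rw [ArithCircuit.Computes, ArithCircuit.eval_ofConst, hfc],
      by rw [productDepth_ofConst]; exact Nat.zero_le _,
      by rw [edgeSize_eq_zero_of_gates_eq_nil _ rfl]; exact Nat.zero_le _⟩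

end Literature.Computability.AlgebraicComplexity.DepthReduction
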